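import Summits.CriticalPhenomena.CardyFormulaZ2.Theorems.CardyIKTransportIKMixedBoxCrossingTransportVerticalClause

/-!
# `CardyIKTransport.IKLinearTransport` (stmt-CriticalPhenomena-5076), line `pinned-diagram-exchange`, lead c8 —
# WALL DOMINATION: an FKG substitute across a column for the column-mixed Izergin–Korepin gauge (VOCABULARY)

Definitions-only support file (`--supports stmt-CriticalPhenomena-5076`).  Nothing is asserted: every
`def … : Prop` below is a statement the LINE POSITS (a registered sub-goal of `stub_ringAll`), never a literature
fact; the few theorems are closure properties of the new notions, sorry-free.

THE OBSERVATION (lead c8).  The sister line's monotone Yang–Baxter transport (crux `IKMixedBoxCrossing`,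
stmt-5911, `…TransportVerticalClause` p138511: `LastColLinkMono → LastFaceMono → ArcsIsoGeHon`) proves that the
probability of the ARCS EVENT of the wall column (cell column `0`) of a cylinder slab is monotone in the face types
(honeycomb `≤` isotropic).  Two features of that proof are not used by it:
* its analytic half (`LinkTraceIneq`, `LinkTelescope`) is stated for EVERY increasing function of the gap-crossing
  vector of the new column, and its combinatorial half (`LinkArcsIff`, path surgery) is about black connectivity
  between ARBITRARY old cells; so the monotonicity holds for every event that is an increasing function of the black
  connectivity relation among the wall cells — `WallMonotone` (§1) — and, the completions' total weight being
  independent of the interior (doubly stochastic kernels, `CylBunchStub.colSum_eq_colConst`), CONDITIONALLY on the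
  wall colouring (`WallMonotone` is closed under intersection with wall-colour events, `WallMonotone.inter_wallCol`);
* the slab weight factorises over the two half-slabs on either side of any cell column (§3), the half-slab to the
  LEFT of a column is a standard slab read through the rotation by `π` (§4: columns reversed, rows negated — the
  anti-diagonal is mapped to the anti-diagonal, so the face weights are preserved), and stochastic domination of the
  two conditional profile laws composes (iterated sums + layer cake).
CONSEQUENCE (`TwoWallDomination`, §5): for EVERY face-type pattern `τ`, every event that is increasing in the PAIR
(left wall profile, right wall profile) of one cell column has slab probability at least its all-honeycomb (site-`𝕋`)
probability.  In site `𝕋` Harris glues the two sides; the pinned coincidence at the wall that every one-sided attempt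
must pay for (lead c7, `Cruxes/IKLinearTransport/RingsIsoNegative-c7.md` §4) is inherited from `𝕋`, not paid.
Exact enumeration (lead c8, `compute/halfslab.c`: `≤ 2` face columns per side, circumference `≤ 8`, all `τ`, all wall
colourings, all principal up-sets) confirms `OneWallDomination` conditionally on the wall and `TwoWallDomination` to
`1e-16`; the same enumeration on the planar FREE box (`compute/openslab.c`) FAILS both (boundary rows), so the
cylinder is essential and planar statements go through the band comparison `CylPlane.cylProb_bandQ_le`.

Contents: §1 wall profile, `WallMonotone`, closure lemmas · §2 the general last-column link function `PhiUV` and the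
sub-goal statements `H1Gen`, `LinkConstGen`, `PermInvariance`, `LastColMonoGen`, `OneWallDomination` · §3 two walls:
`resGE`, `joinCfg`, `midCol`, `leftRel`, `rightRel`, `TwoWallMonotone`, `ProductStructure` · §4 the rotation `rotCyl`,
`LastWallMonotone`, `RotInvariance` · §5 `TwoWallDomination` · §6 registered names and the two compositions
(sorry-free): `oneWallDomination_of`, `twoWallDomination_of`.
-/

noncomputable section

namespace Summit.CriticalPhenomena.CardyFormulaZ2.Theorems.IKLinearTransport.PinnedDiagramExchange.WallDomination

open scoped BigOperators Classical
open Finset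
open Summit.CriticalPhenomena.CardyFormulaZ2.Cruxes.IKMixedBoxCrossing.DefectClosureExploration
open CylBunchStub (resLE resLast splitEquiv colConst)

variable {w L : ℕ}

/-! ## §1 The wall profile and wall-monotone events -/

/-- The WALL PROFILE of a slab configuration: the pairs of rows whose wall cells (cell column `0`) are joined by a
black path inside the slab. -/
def wallRel (x : CylCfg w L) : Set (ZMod L × ZMod L) :=
  {rs | BlackConn x ((0 : Fin (w + 1)), rs.1) ((0 : Fin (w + 1)), rs.2)}

/-- The colouring of the wall column. -/
def wallCol (x : CylCfg w L) : ZMod L → Bool := fun r => x.1 ((0 : Fin (w + 1)), r)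

/-- `E` is WALL-MONOTONE: it depends on the configuration only through the wall colouring and the wall profile,
increasingly in the profile (any monotone Boolean combination of "these two wall arcs are joined inside the slab",
intersected with any event of the wall colouring). -/
def WallMonotone (E : Set (CylCfg w L)) : Prop :=
  ∀ x y : CylCfg w L, wallCol x = wallCol y → wallRel x ⊆ wallRel y → x ∈ E → y ∈ E

namespace WallMonotone

/-- `univ` is wall-monotone. -/
theorem univ : WallMonotone (Set.univ : Set (CylCfg w L)) := fun _ _ _ _ _ => Set.mem_univ _

/-- Intersections of wall-monotone events are wall-monotone. -/
theorem inter {E F : Set (CylCfg w L)} (hE : WallMonotone E) (hF : WallMonotone F) : WallMonotone (E ∩ F) :=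
  fun x y hc hr h => ⟨hE x y hc hr h.1, hF x y hc hr h.2⟩

/-- Unions of wall-monotone events are wall-monotone. -/
theorem union {E F : Set (CylCfg w L)} (hE : WallMonotone E) (hF : WallMonotone F) : WallMonotone (E ∪ F) :=
  fun x y hc hr h => h.elim (fun h => Or.inl (hE x y hc hr h)) (fun h => Or.inr (hF x y hc hr h))

/-- A wall-monotone event cut down to a wall colouring is wall-monotone (this is what makes the domination hold
CONDITIONALLY on the wall). -/
theorem inter_wallCol {E : Set (CylCfg w L)} (hE : WallMonotone E) (ξ : ZMod L → Bool) :
    WallMonotone (E ∩ {x | wallCol x = ξ}) :=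
  fun x y hc hr h => ⟨hE x y hc hr h.1, by rw [Set.mem_setOf_eq, ← hc]; exact h.2⟩

/-- "The wall arcs of rows in `A` and in `B` are joined inside the slab" is wall-monotone. -/
theorem joined (A B : Set (ZMod L)) :
    WallMonotone {x : CylCfg w L | ∃ r ∈ A, ∃ s ∈ B, BlackConn x ((0 : Fin (w + 1)), r) ((0 : Fin (w + 1)), s)} :=
  fun _ _ _ hr ⟨r, hrA, s, hsB, h⟩ => ⟨r, hrA, s, hsB, hr (show (r, s) ∈ wallRel _ from h)⟩

end WallMonotone

/-- The transported arcs event of the sister line is wall-monotone. -/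
theorem wallMonotone_arcsEvent (w L n : ℕ) : WallMonotone (arcsEvent w L n) :=
  fun _ _ _ hr ⟨r₁, r₂, h1, h2, h3, h4, h⟩ => ⟨r₁, r₂, h1, h2, h3, h4, hr (show (r₁, r₂) ∈ wallRel _ from h)⟩

/-! ## §2 One wall: the general link function and the sub-goal statements -/

/-- THE GENERAL NECKLACE LINK FUNCTION between two OLD cells `u, v` of the interior slab `y` (whose last cell column
the necklace `N` presents) at the gap-crossing vector `x` of a new column: `u` and `v` are already joined inside `y`,
or `u` is joined inside `y` to some run, `v` to some run, and the two runs are chained by links (`Necklace.Linked`: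
consecutive runs with the gap between them crossed, or runs of one interior cluster).  The arcs link function
`Necklace.Phi` of the sister line is its special case `u, v` on the two arcs. -/
def PhiUV (N : Necklace L) (y : CylCfg w L) (u v : Fin (w + 1) × ZMod L) (x : Fin N.k → Bool) : Prop :=
  BlackConn y u v ∨ ∃ i j : Fin N.k, (∃ a ∈ N.runCells i, BlackConn y u a) ∧ (∃ b ∈ N.runCells j, BlackConn y v b) ∧
    Relation.ReflTransGen (N.Linked y x) i j

/-- `PhiUV` is increasing in the crossing vector. -/
theorem PhiUV_mono (N : Necklace L) (y : CylCfg w L) (u v : Fin (w + 1) × ZMod L) {x x' : Fin N.k → Bool}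
    (hle : x ≤ x') (h : PhiUV N y u v x) : PhiUV N y u v x' := by
  rcases h with h | ⟨i, j, hi, hj, hij⟩
  · exact Or.inl h
  · refine Or.inr ⟨i, j, hi, hj, Relation.ReflTransGen.mono (fun a b hab => ?_) _ _ hij⟩
    rcases hab with ⟨ha, hb⟩ | ⟨ha, hb⟩ | hc
    · exact Or.inl ⟨Bool.eq_true_of_true_le (ha ▸ hle a), hb⟩
    · exact Or.inr (Or.inl ⟨Bool.eq_true_of_true_le (ha ▸ hle b), hb⟩)
    · exact Or.inr (Or.inr hc)

/-- H1-GENERAL · BLACK CONNECTIVITY BETWEEN OLD CELLS OF THE WIDER SLAB = `PhiUV` AT THE CROSSING VECTOR (the path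
surgery of `stub_linkArcsIff` with the first arc replaced by an arbitrary old cell).
  A statement to be proved (registered sub-goal), not asserted here. -/
def H1Gen : Prop :=
  ∀ (w L : ℕ) [NeZero L] (y : CylCfg w L) (N : Necklace L), N.col = (fun r => y.1 (Fin.last w, r)) →
    ∀ (c f : ZMod L → Bool) (u v : Fin (w + 1) × ZMod L),
      BlackConn ((splitEquiv w L).symm (y, (c, f))) (u.1.castSucc, u.2) (v.1.castSucc, v.2) ↔
        PhiUV N y u v (N.crossVec c f)

/-- CONSTANT LAST INTERIOR COLUMN · then black connectivity between old cells of the wider slab does not depend on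
the new column (`NecklaceConstStub.reach_transfer`).
  A statement to be proved (registered sub-goal), not asserted here. -/
def LinkConstGen : Prop :=
  ∀ (w L : ℕ) [NeZero L] (y : CylCfg w L) (b : Bool), (∀ r, y.1 (Fin.last w, r) = b) →
    ∀ (p q : (ZMod L → Bool) × (ZMod L → Bool)) (u v : Fin (w + 1) × ZMod L),
      BlackConn ((splitEquiv w L).symm (y, p)) (u.1.castSucc, u.2) (v.1.castSucc, v.2) ↔
        BlackConn ((splitEquiv w L).symm (y, q)) (u.1.castSucc, u.2) (v.1.castSucc, v.2)

/-- PERMUTATION INVARIANCE · the slab probability of an event determined off every interior cell column given the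
block diagram around it (`OffColDetermined`, in particular every wall-monotone event) is invariant under every
permutation of the face types (`CylExchange` for adjacent face types of different kind; adjacent transpositions
generate the symmetric group — the sister line's `CylBunchStub.cylArcs_comp_perm` with the event freed).
  A statement to be proved (registered sub-goal), not asserted here. -/
def PermInvariance : Prop :=
  ∀ (w L : ℕ) [NeZero L], 3 ≤ L → ∀ (E : Set (CylCfg w L)),
    (∀ (i : ℕ) (hi : i + 1 < w), OffColDetermined w L i hi E) →
      ∀ (σ : Equiv.Perm (Fin w)) (τ : Fin w → Bool), cylProb w L (τ ∘ σ) E = cylProb w L τ E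

/-- WALL-MONOTONE EVENTS ARE DETERMINED OFF EVERY INTERIOR COLUMN (`SlabDetStub.blackConn_congr`: the wall is never
the exchanged column).
  A statement to be proved (registered sub-goal), not asserted here. -/
def WallMonotoneOffCol : Prop :=
  ∀ (w L : ℕ) (E : Set (CylCfg w L)), WallMonotone E → ∀ (i : ℕ) (hi : i + 1 < w), OffColDetermined w L i hi E

/-- POINTWISE LAST-COLUMN MONOTONICITY FOR WALL-MONOTONE EVENTS · for every interior configuration of the slab of `w`
face columns, the normalised weighted number of completions of a wall-monotone event of the wider slab through an
ISOTROPIC last face column is at least the one through a HONEYCOMB last face column (`LastColLinkMono` with the arcs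
event freed: `H1Gen` + `LinkConstGen` + the landed `LinkHonCount`, `LinkIsoTrace`, `LinkTelescope`, `LinkTraceIneq`,
`LinkNorm`, `NecklaceExists`).
  A statement to be proved (registered sub-goal), not asserted here. -/
def LastColMonoGen : Prop :=
  ∀ (w L : ℕ) [NeZero L], 3 ≤ L → ∀ (E : Set (CylCfg (w + 1) L)), WallMonotone E → ∀ y : CylCfg w L,
    lastColSum false L E y / colConst false L ≤ lastColSum true L E y / colConst true L

/-- **ONE-WALL DOMINATION** · for every face-type pattern the slab probability of a wall-monotone event is at least
its all-honeycomb (site-`𝕋`) probability.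
  A statement to be proved (registered sub-goal), not asserted here. -/
def OneWallDomination : Prop :=
  ∀ (w L : ℕ) [NeZero L], 3 ≤ L → ∀ (τ : Fin w → Bool) (E : Set (CylCfg w L)), WallMonotone E →
    cylProb w L (fun _ => false) E ≤ cylProb w L τ E

/-! ## §3 Two walls: the slab of `w₁ + w₂` face columns cut at the cell column `w₁` -/

variable {w₁ w₂ : ℕ}

/-- Restriction to the RIGHT part: cell columns `w₁ … w₁ + w₂` and face columns `w₁ … w₁ + w₂ - 1`, re-indexed
from `0` (so the middle column becomes the wall of a standard slab of `w₂` face columns). -/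
def resGE (w₁ w₂ : ℕ) (x : CylCfg (w₁ + w₂) L) : CylCfg w₂ L :=
  (fun c => x.1 (⟨w₁ + c.1.val, by omega⟩, c.2), fun f => x.2 (⟨w₁ + f.1.val, by omega⟩, f.2))

/-- JOINING a left part and a right part along the middle column (the middle column is read from the LEFT part; the
two parts are meant to agree there). -/
def joinCfg (a : CylCfg w₁ L) (b : CylCfg w₂ L) : CylCfg (w₁ + w₂) L :=
  (fun c => if h : c.1.val ≤ w₁ then a.1 (⟨c.1.val, by omega⟩, c.2) else b.1 (⟨c.1.val - w₁, by omega⟩, c.2),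
    fun f => if h : f.1.val < w₁ then a.2 (⟨f.1.val, h⟩, f.2) else b.2 (⟨f.1.val - w₁, by omega⟩, f.2))

/-- The colouring of the middle column. -/
def midCol (w₁ w₂ : ℕ) (x : CylCfg (w₁ + w₂) L) : ZMod L → Bool := fun r => x.1 (⟨w₁, by omega⟩, r)

/-- The LEFT profile of the middle column: pairs of rows whose middle cells are joined by a black path inside the
left part (cell columns `0 … w₁`). -/
def leftRel (w₁ w₂ : ℕ) (x : CylCfg (w₁ + w₂) L) : Set (ZMod L × ZMod L) :=
  {rs | BlackConn (resLE (Nat.le_add_right w₁ w₂) x) (Fin.last w₁, rs.1) (Fin.last w₁, rs.2)}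

/-- The RIGHT profile of the middle column: pairs of rows whose middle cells are joined by a black path inside the
right part (cell columns `w₁ … w₁ + w₂`). -/
def rightRel (w₁ w₂ : ℕ) (x : CylCfg (w₁ + w₂) L) : Set (ZMod L × ZMod L) := wallRel (resGE w₁ w₂ x)

/-- `E` is TWO-WALL-MONOTONE at the middle column `w₁`: it depends on the configuration only through the middle
colouring and the two profiles, increasingly in both profiles (e.g. "some middle cell of the arc `A` is joined to some
middle cell of the arc `B` inside the left part AND inside the right part" — a black circuit through the wall). -/
def TwoWallMonotone (w₁ w₂ : ℕ) (E : Set (CylCfg (w₁ + w₂) L)) : Prop :=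
  ∀ x y : CylCfg (w₁ + w₂) L, midCol w₁ w₂ x = midCol w₁ w₂ y → leftRel w₁ w₂ x ⊆ leftRel w₁ w₂ y →
    rightRel w₁ w₂ x ⊆ rightRel w₁ w₂ y → x ∈ E → y ∈ E

/-- The face types of the left part and of the right part. -/
def τL (τ : Fin (w₁ + w₂) → Bool) : Fin w₁ → Bool := fun j => τ (Fin.castAdd w₂ j)

/-- The face types of the right part. -/
def τR (τ : Fin (w₁ + w₂) → Bool) : Fin w₂ → Bool := fun j => τ (Fin.natAdd w₁ j)

/-- PRODUCT STRUCTURE · (i) summing over the slab is summing over left parts and right parts agreeing on the middle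
column; (ii) the slab weight of a join is the product of the weights of its parts; (iii) restricting a join gives the
parts back; (iv) the total weight of the configurations of a standard slab with a PRESCRIBED wall colouring is the
product of the column constants (doubly stochastic face kernels, `CylBunchStub.sum_resLast`), whatever the colouring.
  A statement to be proved (registered sub-goal), not asserted here. -/
def ProductStructure : Prop :=
  (∀ (w₁ w₂ L : ℕ) [NeZero L] (F : CylCfg (w₁ + w₂) L → ℝ),
    ∑ x, F x = ∑ a : CylCfg w₁ L, ∑ b : CylCfg w₂ L,
      if (fun r => a.1 (Fin.last w₁, r)) = wallCol b then F (joinCfg a b) else 0) ∧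
  (∀ (w₁ w₂ L : ℕ) [NeZero L] (τ : Fin (w₁ + w₂) → Bool) (a : CylCfg w₁ L) (b : CylCfg w₂ L),
    (fun r => a.1 (Fin.last w₁, r)) = wallCol b →
      cylWeight (w₁ + w₂) L τ (joinCfg a b) = cylWeight w₁ L (τL τ) a * cylWeight w₂ L (τR τ) b) ∧
  (∀ (w₁ w₂ L : ℕ) (a : CylCfg w₁ L) (b : CylCfg w₂ L), (fun r => a.1 (Fin.last w₁, r)) = wallCol b →
    resLE (Nat.le_add_right w₁ w₂) (joinCfg a b) = a ∧ resGE w₁ w₂ (joinCfg a b) = b) ∧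
  (∀ (w L : ℕ) [NeZero L] (τ : Fin w → Bool) (ξ : ZMod L → Bool),
    (∑ x : CylCfg w L, if wallCol x = ξ then cylWeight w L τ x else 0) = ∏ j, colConst (τ j) L)

/-! ## §4 The rotation by `π` -/

/-- ROTATION BY `π` of a slab configuration: cell `(i, r) ↦ (w - i, -r)`, face `(j, r) ↦ (w - 1 - j, -r - 1)`.  The
four corners of a face are mapped to the four corners of the image face and the anti-diagonal to the anti-diagonal,
so parities and flags — hence the face weights — are preserved, with the face types reversed. An involution. -/
def rotCyl (x : CylCfg w L) : CylCfg w L :=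
  (fun c => x.1 (Fin.rev c.1, -c.2), fun f => x.2 (Fin.rev f.1, -f.2 - 1))

/-- `E` is LAST-WALL-MONOTONE: wall-monotone with respect to the LAST cell column `w` instead of the first. -/
def LastWallMonotone (E : Set (CylCfg w L)) : Prop :=
  ∀ x y : CylCfg w L, (fun r => x.1 (Fin.last w, r)) = (fun r => y.1 (Fin.last w, r)) →
    {rs : ZMod L × ZMod L | BlackConn x (Fin.last w, rs.1) (Fin.last w, rs.2)} ⊆
      {rs | BlackConn y (Fin.last w, rs.1) (Fin.last w, rs.2)} → x ∈ E → y ∈ E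

/-- ROTATION INVARIANCE · (i) `rotCyl` is an involution; (ii) it preserves the slab weight with the face types
reversed; (iii) it transports black connectivity; hence (iv) slab probabilities with reversed types and (v) it turns
last-wall-monotone events into wall-monotone ones.
  A statement to be proved (registered sub-goal), not asserted here. -/
def RotInvariance : Prop :=
  (∀ (w L : ℕ) (x : CylCfg w L), rotCyl (rotCyl x) = x) ∧
  (∀ (w L : ℕ) [NeZero L] (τ : Fin w → Bool) (x : CylCfg w L),
    cylWeight w L (τ ∘ Fin.rev) (rotCyl x) = cylWeight w L τ x) ∧
  (∀ (w L : ℕ) (x : CylCfg w L) (u v : Fin (w + 1) × ZMod L),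
    BlackConn (rotCyl x) u v ↔ BlackConn x (Fin.rev u.1, -u.2) (Fin.rev v.1, -v.2)) ∧
  (∀ (w L : ℕ) [NeZero L] (τ : Fin w → Bool) (E : Set (CylCfg w L)),
    cylProb w L (τ ∘ Fin.rev) (rotCyl ⁻¹' E) = cylProb w L τ E) ∧
  (∀ (w L : ℕ) (E : Set (CylCfg w L)), LastWallMonotone E → WallMonotone (rotCyl ⁻¹' E))

/-! ## §5 Two-wall domination -/

/-- **TWO-WALL DOMINATION** (the FKG substitute across a column) · for every face-type pattern the slab probability
of an event increasing in the two profiles of the middle column is at least its all-honeycomb (site-`𝕋`) probability.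
  A statement to be proved (registered sub-goal), not asserted here. -/
def TwoWallDomination : Prop :=
  ∀ (w₁ w₂ L : ℕ) [NeZero L], 3 ≤ L → ∀ (τ : Fin (w₁ + w₂) → Bool) (E : Set (CylCfg (w₁ + w₂) L)),
    TwoWallMonotone w₁ w₂ E → cylProb (w₁ + w₂) L (fun _ => false) E ≤ cylProb (w₁ + w₂) L τ E

/-- LAST-FACE MONOTONICITY FOR WALL-MONOTONE EVENTS (Fubini over the last column, `LastFaceMonoStub.num_snoc`):
switching the last face type from honeycomb to isotropic does not decrease the probability of a wall-monotone event.
  A statement to be proved (registered sub-goal), not asserted here. -/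
def LastFaceMonoGen : Prop :=
  ∀ (w L : ℕ) [NeZero L], 3 ≤ L → ∀ (τ : Fin w → Bool) (E : Set (CylCfg (w + 1) L)), WallMonotone E →
    cylProb (w + 1) L (Fin.snoc τ false) E ≤ cylProb (w + 1) L (Fin.snoc τ true) E

/-- THE TWO-SIDED COMPOSITION (iterated sums over the product structure, the one-wall domination on the right part,
the rotated one-wall domination on the left part through a finite layer cake).
  A statement to be proved (registered sub-goal), not asserted here. -/
def TwoWallOfOne : Prop := OneWallDomination → ProductStructure → RotInvariance → TwoWallDomination

/-! ## §6 Registered names and the compositions (sorry-free) -/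

namespace Registered

/-- Alias keyed by the registered sub-goal name (H1 general: path surgery). -/
abbrev stub_h1Gen : Prop := H1Gen
/-- Alias keyed by the registered sub-goal name. -/
abbrev stub_linkConstGen : Prop := LinkConstGen
/-- Alias keyed by the registered sub-goal name. -/
abbrev stub_permInvariance : Prop := PermInvariance
/-- Alias keyed by the registered sub-goal name. -/
abbrev stub_wallMonotoneOffCol : Prop := WallMonotoneOffCol
/-- Alias keyed by the registered sub-goal name (the pointwise heart, freed). -/
abbrev stub_lastColMonoGen : Prop := H1Gen → LinkConstGen → LastColMonoGen
/-- Alias keyed by the registered sub-goal name (Fubini). -/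
abbrev stub_lastFaceMonoGen : Prop := LastColMonoGen → LastFaceMonoGen
/-- Alias keyed by the registered sub-goal name (induction on the number of isotropic face columns + sorting). -/
abbrev stub_oneWallDomination_of : Prop := PermInvariance → WallMonotoneOffCol → LastFaceMonoGen → OneWallDomination
/-- Alias keyed by the registered sub-goal name. -/
abbrev stub_productStructure : Prop := ProductStructure
/-- Alias keyed by the registered sub-goal name. -/
abbrev stub_rotInvariance : Prop := RotInvariance
/-- Alias keyed by the registered sub-goal name (the two-sided composition). -/
abbrev stub_twoWallOfOne : Prop := TwoWallOfOne

end Registered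

/-- **One-wall domination from the registered sub-goals** (registered composition, no `sorry`). -/
theorem oneWallDomination_of :
    Registered.stub_h1Gen → Registered.stub_linkConstGen → Registered.stub_permInvariance →
      Registered.stub_wallMonotoneOffCol → Registered.stub_lastColMonoGen → Registered.stub_lastFaceMonoGen →
      Registered.stub_oneWallDomination_of → OneWallDomination :=
  fun h1 h2 h3 h4 h5 h6 h7 => h7 h3 h4 (h6 (h5 h1 h2))

/-- **Two-wall domination from the registered sub-goals** (registered composition, no `sorry`). -/
theorem twoWallDomination_of :
    Registered.stub_h1Gen → Registered.stub_linkConstGen → Registered.stub_permInvariance →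
      Registered.stub_wallMonotoneOffCol → Registered.stub_lastColMonoGen → Registered.stub_lastFaceMonoGen →
      Registered.stub_oneWallDomination_of → Registered.stub_productStructure → Registered.stub_rotInvariance →
      Registered.stub_twoWallOfOne → TwoWallDomination :=
  fun h1 h2 h3 h4 h5 h6 h7 h8 h9 h10 => h10 (oneWallDomination_of h1 h2 h3 h4 h5 h6 h7) h8 h9

end Summit.CriticalPhenomena.CardyFormulaZ2.Theorems.IKLinearTransport.PinnedDiagramExchange.WallDomination

end
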